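import Mathlib
import Summits.CriticalPhenomena.CardyFormulaZ2.Theorems.CardyFlipRussoSquareFromVoronoiHubDefs
import Summits.CriticalPhenomena.CardyFormulaZ2.Theorems.CardyFlipRussoSquareFromVoronoiHubFaithfulPart4
import Summits.CriticalPhenomena.CardyFormulaZ2.Theorems.CardyFlipRussoSquareFromVoronoiHubFaithfulPart6
import Summits.CriticalPhenomena.CardyFormulaZ2.Theorems.CardyFlipRussoSquareFromVoronoiHubFaithfulPart8
import Literature.Probability.Percolation.VoronoiCrossing

/-!
# Stub `stub_sandwich_of` (K1, S3 + S4), line `Sketch` of crux `SquareFromVoronoiHub` — Part 1: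
# the two deterministic inclusions of the dual sandwich

Crux `Summit.CriticalPhenomena.CardyFormulaZ2.Theses.CardyFlipRusso.SquareFromVoronoiHub`
(stmt-CriticalPhenomena-6434), line `Sketch` (card `voronoi-blocks-on-fixed-gs`), K1 ("faithful
discretisation" at cell scale `ε = δ^{1/8}`), registered stub `stub_sandwich_of` (S3 + S4: the
perturbed rectangles, the no-defect bound and the fat tube give the SANDWICH); registered
sub-goal `stub_sandwich_of_part1`.  This file is the DETERMINISTIC half of the assembly — no
probability, no thresholds; the fat tubes and the clauses of the specs `lowerMargins` /
`upperMargins` of the perturbed rectangles enter as unfolded hypotheses: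

* `exists_mem_arc_two_of_split` (**last exit through `(cd)`**, the mirror image of Part 5's
  `exists_first_entry`): a path from the `(ab)`-side piece `F₀` of a splitting to a point of the
  `(cd)`-side piece `F₂` off `closure Ω`, away from `(bc)`, `(da)`, meets the arc `(cd)` (its last
  point in `closure Ω` is a frontier point in `F₂`, hence on no arc but `(cd)`);
* `blockConfig_mem_crudeCrossing_of_tube` (**S3, lower inclusion**): a strictly black fat tube
  shadowing a continuum crossing of the lower perturbed rectangle `R₁` within `4ρ ≤ r`, where `r`
  satisfies the cap/collar clauses of `lowerMargins R R₁ F₀ F₂` and `δ < r`, `δ/2 < μ`, gives the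
  crude block crossing of `R` at mesh `δ` (Part 6 `blockConfig_mem_crudeCrossing_of_split_path`,
  its `hy` being the last exit above);
* `false_of_block_of_whiteTube` (**S4, upper exclusion**): a crude block crossing of `R` and a
  strictly white fat tube shadowing a white crossing of the upper perturbed rectangle `R₂` are
  incompatible under the crossing clause of `upperMargins R R₂` (`4ρ, 2δ ≤ r`, `δ/2 < μ`): the
  polygonal interpolation of the open lattice path (Part 4 `exists_joinedIn_of_mem_crudeCrossing`
  with `K` = the `δ/2`-neighbourhood of the black sites in `Ω`, segments of length `≤ δ` by Part 8
  `dist_le_of_Gs_adj`) meets the white tube at a point within `δ/2 < μ` of a black site lying in a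
  strictly white ball.

(Bollobás–Riordan, *Percolation* (2006), Ch. 7 (19)/Lemma 14 and Ch. 8 §8.3.)
-/

noncomputable section

namespace Summit.CriticalPhenomena.CardyFormulaZ2.Cruxes.SquareFromVoronoiHub.VoronoiBlocks.Faithful

open scoped Pointwise Topology
open Set Metric Filter
open Literature.Probability.Percolation (SiteConfig blackRegion mem_blackRegion)
open Literature.Probability.RandomPlanarGeometry (ConformalRectangle)
open Literature.Analysis.FunctionSpaces (PointConfig)

/-! ### Last exit through `(cd)` -/

/-- **Last exit through `(cd)`.**  Let `F₀`, `F₂` be disjoint closed sets containing every point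
of the path `γ` off `closure Ω`, with `F₂` at distance `> M > 0` from `(ab) = R.arc 0`; let `γ`
start in `F₀`, end off `closure Ω` inside `F₂`, and stay at distance `> M` from `(bc)`, `(da)`.
Then `γ` meets the arc `(cd) = R.arc 2`: the path meets `closure Ω` (else its connected range
lies in `F₀` or in `F₂`), its last point in `closure Ω` is a limit of the off-`closure Ω` tail,
which is connected, ends in `F₂`, hence lies in `F₂`; so that point is a frontier point in
`F₂`, i.e. on no arc but `(cd)`.  Mirror image of Part 5's `exists_first_entry`. [folklore] -/
theorem exists_mem_arc_two_of_split (R : ConformalRectangle) {M : ℝ} (hM : 0 < M) {x y : ℂ}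
    (γ : Path x y) {F₀ F₂ : Set ℂ} (hF₀ : IsClosed F₀) (hF₂ : IsClosed F₂) (hdisj : Disjoint F₀ F₂)
    (hout : ∀ t, γ t ∉ closure R.carrier → γ t ∈ F₀ ∪ F₂)
    (h₂ : ∀ z ∈ F₂, M < infDist z (R.arc 0))
    (h1 : ∀ t, M < infDist (γ t) (R.arc 1)) (h3 : ∀ t, M < infDist (γ t) (R.arc 3))
    (hxF : x ∈ F₀) (hy : y ∉ closure R.carrier) (hyF : y ∈ F₂) :
    ∃ t, γ t ∈ R.arc 2 := by
  have hcont : Continuous γ.extend := γ.continuous_extend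
  -- the (closed) set of times in `closure Ω`, and its supremum `u`
  set S : Set ℝ := Icc 0 1 ∩ γ.extend ⁻¹' closure R.carrier with hS
  have hSc : IsClosed S := isClosed_Icc.inter (isClosed_closure.preimage hcont)
  have hSne : S.Nonempty := by
    by_contra hne
    rw [Set.not_nonempty_iff_eq_empty] at hne
    have hall : ∀ t : unitInterval, γ t ∉ closure R.carrier := fun t ht =>
      (Set.eq_empty_iff_forall_notMem.1 hne) t ⟨t.2, by rwa [mem_preimage, Path.extend_extends']⟩
    have hsub : range γ ⊆ F₀ ∪ F₂ := by
      rintro _ ⟨t, rfl⟩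
      exact hout t (hall t)
    have hpre : IsPreconnected (range γ) := isPreconnected_range γ.continuous
    have hempty : range γ ∩ (F₀ ∩ F₂) = ∅ := by rw [hdisj.inter_eq, inter_empty]
    rcases (isPreconnected_iff_subset_of_disjoint_closed.1 hpre) F₀ F₂ hF₀ hF₂ hsub hempty with h | h
    · exact Set.disjoint_left.1 hdisj (by simpa using h ⟨1, rfl⟩) hyF
    · exact Set.disjoint_left.1 hdisj hxF (by simpa using h ⟨0, rfl⟩)
  have hSbdd : BddAbove S := ⟨1, fun t ht => ht.1.2⟩
  set u := sSup S with hu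
  have huS : u ∈ S := hSc.csSup_mem hSne hSbdd
  have hu0 : 0 ≤ u := huS.1.1
  have hu1 : u ≤ 1 := huS.1.2
  have hafter : ∀ t ∈ Ioc u 1, γ.extend t ∉ closure R.carrier := by
    intro t ht h
    have : t ∈ S := ⟨⟨hu0.trans ht.1.le, ht.2⟩, h⟩
    exact (le_csSup hSbdd this).not_gt ht.1
  have hu1' : u < 1 := by
    rcases hu1.lt_or_eq with h | h
    · exact h
    · exfalso
      have : γ.extend u ∈ closure R.carrier := huS.2
      rw [h, γ.extend_one] at this
      exact hy this
  -- after `u` the path is off `closure Ω` and inside `F₂`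
  have hF₂after : ∀ t ∈ Ioc u 1, γ.extend t ∈ F₂ := by
    intro t ht
    have hsub : γ.extend '' Ioc u 1 ⊆ F₀ ∪ F₂ := by
      rintro _ ⟨v, hv, rfl⟩
      have hv01 : v ∈ Icc (0 : ℝ) 1 := ⟨hu0.trans hv.1.le, hv.2⟩
      rw [Path.extend_apply γ hv01]
      exact hout _ (by rw [← Path.extend_apply γ hv01]; exact hafter v hv)
    have hpre : IsPreconnected (γ.extend '' Ioc u 1) :=
      isPreconnected_Ioc.image _ hcont.continuousOn
    have hempty : γ.extend '' Ioc u 1 ∩ (F₀ ∩ F₂) = ∅ := by rw [hdisj.inter_eq, inter_empty]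
    have h1mem : (1 : ℝ) ∈ Ioc u 1 := ⟨hu1', le_rfl⟩
    rcases (isPreconnected_iff_subset_of_disjoint_closed.1 hpre) F₀ F₂ hF₀ hF₂ hsub hempty with h | h
    · exfalso
      have hy0 : y ∈ F₀ := by simpa [γ.extend_one] using h ⟨1, h1mem, rfl⟩
      exact Set.disjoint_left.1 hdisj hy0 hyF
    · exact h ⟨t, ht, rfl⟩
  -- the exit point is in `F₂` (closedness) and on the frontier, hence on `(cd)`
  have hT : Tendsto γ.extend (𝓝[>] u) (𝓝 (γ.extend u)) :=
    (hcont.tendsto u).mono_left nhdsWithin_le_nhds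
  have hmemF₂ : γ.extend u ∈ F₂ := by
    refine hF₂.mem_of_tendsto hT ?_
    filter_upwards [Ioc_mem_nhdsGT hu1'] with v hv
    exact hF₂after v hv
  have hfr : γ.extend u ∈ frontier R.carrier := by
    have hcl : γ.extend u ∈ closure R.carrier := huS.2
    rw [closure_eq_self_union_frontier] at hcl
    rcases hcl with hΩ | hfr
    · exfalso
      have hev : ∀ᶠ v in 𝓝[>] u, γ.extend v ∈ R.carrier := hT (R.isOpen.mem_nhds hΩ)
      have hev' : ∀ᶠ v in 𝓝[>] u, v ∈ Ioc u 1 := Ioc_mem_nhdsGT hu1'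
      obtain ⟨v, hv, hv'⟩ := (hev.and hev').exists
      exact hafter v hv' (subset_closure hv)
    · exact hfr
  have hu01 : u ∈ Icc (0 : ℝ) 1 := ⟨hu0, hu1⟩
  refine ⟨⟨u, hu01⟩, ?_⟩
  rw [← Path.extend_apply γ hu01]
  have hU : ⋃ i, R.arc i = frontier R.carrier := R.iUnion_arc_holds
  rw [← hU, mem_iUnion] at hfr
  obtain ⟨i, hi⟩ := hfr
  fin_cases i
  · exfalso
    have hi' : γ.extend u ∈ R.arc 0 := hi
    have := h₂ _ hmemF₂
    rw [infDist_zero_of_mem hi'] at this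
    exact this.not_ge hM.le
  · exfalso
    have hi' : γ.extend u ∈ R.arc 1 := hi
    have := h1 ⟨u, hu01⟩
    rw [← Path.extend_apply γ hu01, infDist_zero_of_mem hi'] at this
    exact this.not_ge hM.le
  · exact hi
  · exfalso
    have hi' : γ.extend u ∈ R.arc 3 := hi
    have := h3 ⟨u, hu01⟩
    rw [← Path.extend_apply γ hu01, infDist_zero_of_mem hi'] at this
    exact this.not_ge hM.le

/-! ### S3: the lower inclusion (black fat tube ⇒ crude block crossing) -/

/-- **S3 — lower inclusion, deterministic part.**  Let `r > δ` satisfy the cap/collar clauses of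
`lowerMargins R R₁ F₀ F₂` (closed disjoint cap sets `F₀`, `F₂`; `F₀` at distance `≥ r` from
`(cd)`, `F₂` from `(ab)`; the `r`-neighbourhood of `closure R₁` at distance `≥ r` from `(bc)`,
`(da)` with off-`closure Ω` part inside `F₀ ∪ F₂`; the `r`-neighbourhoods of `R₁.arc 0`,
`R₁.arc 2` off `closure Ω` inside `F₀`, `F₂`), let `γ ⊆ closure R₁` run from `R₁.arc 0` to
`R₁.arc 2` (a continuum crossing of `R₁`), and let `γ'` be a fat tube shadowing it: endpoints
within `4ρ ≤ r` of those of `γ`, every point within `4ρ` of `γ`, open `μ`-balls (`δ/2 < μ`)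
strictly black for the dilated nuclei.  Then `blockConfig δ s c ∈ crudeCrossing R δ`: Part 6
`blockConfig_mem_crudeCrossing_of_split_path` applies to `γ'`, which starts off `closure Ω` in
`F₀`, ends off `closure Ω` in `F₂` and therefore meets `(cd)` (`exists_mem_arc_two_of_split`).
[folklore] -/
theorem blockConfig_mem_crudeCrossing_of_tube (R R₁ : ConformalRectangle) {δ : ℝ} (hδ : 0 < δ)
    (s : ℝ) (c : PointConfig ℂ × PointConfig ℂ) {F₀ F₂ : Set ℂ} {r ρ μ : ℝ}
    (hF₀ : IsClosed F₀) (hF₂ : IsClosed F₂) (hdisj : Disjoint F₀ F₂)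
    (hA : ∀ z ∈ F₀, r ≤ infDist z (R.arc 2)) (hB : ∀ z ∈ F₂, r ≤ infDist z (R.arc 0))
    (hC : ∀ z, infDist z (closure R₁.carrier) ≤ r →
      r ≤ infDist z (R.arc 1) ∧ r ≤ infDist z (R.arc 3))
    (hD : ∀ z, infDist z (closure R₁.carrier) ≤ r → z ∉ closure R.carrier → z ∈ F₀ ∪ F₂)
    (hE : ∀ z, infDist z (R₁.arc 0) ≤ r → z ∉ closure R.carrier ∧ z ∈ F₀)
    (hF : ∀ z, infDist z (R₁.arc 2) ≤ r → z ∉ closure R.carrier ∧ z ∈ F₂)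
    (hδr : δ < r) (hρr : 4 * ρ ≤ r) (hμ : δ / 2 < μ)
    (h02 : ∀ z, infDist z (R.arc 0) ≤ δ → δ < infDist z (R.arc 2))
    {x y : ℂ} {γ : Path x y} (hx : x ∈ R₁.arc 0) (hy : y ∈ R₁.arc 2)
    (hγ : ∀ t, γ t ∈ closure R₁.carrier)
    {x' y' : ℂ} (γ' : Path x' y') (hx' : dist x' x ≤ 4 * ρ) (hy' : dist y' y ≤ 4 * ρ)
    (hnear : ∀ t, ∃ u, dist (γ' t) (γ u) ≤ 4 * ρ)
    (hball : ∀ t, ball (γ' t) μ ⊆ {z | infDist z ((s : ℂ) • (c.1 : Set ℂ)) <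
      infDist z ((s : ℂ) • (c.2 : Set ℂ))}) :
    blockConfig δ s c ∈ crudeCrossing R δ := by
  have hr4 : ∀ t, infDist (γ' t) (closure R₁.carrier) ≤ r := fun t => by
    obtain ⟨u, hu⟩ := hnear t
    exact (infDist_le_dist_of_mem (hγ u)).trans (hu.trans hρr)
  have hout : ∀ t, γ' t ∉ closure R.carrier → γ' t ∈ F₀ ∪ F₂ := fun t ht => hD _ (hr4 t) ht
  have h₀ : ∀ z ∈ F₀, δ < infDist z (R.arc 2) := fun z hz => hδr.trans_le (hA z hz)
  have h₂ : ∀ z ∈ F₂, δ < infDist z (R.arc 0) := fun z hz => hδr.trans_le (hB z hz)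
  have h1 : ∀ t, δ < infDist (γ' t) (R.arc 1) := fun t => hδr.trans_le (hC _ (hr4 t)).1
  have h3 : ∀ t, δ < infDist (γ' t) (R.arc 3) := fun t => hδr.trans_le (hC _ (hr4 t)).2
  have hx'' : x' ∉ closure R.carrier ∧ x' ∈ F₀ :=
    hE x' ((infDist_le_dist_of_mem hx).trans (hx'.trans hρr))
  have hy'' : y' ∉ closure R.carrier ∧ y' ∈ F₂ :=
    hF y' ((infDist_le_dist_of_mem hy).trans (hy'.trans hρr))
  obtain ⟨t₂, ht₂⟩ :=
    exists_mem_arc_two_of_split R hδ γ' hF₀ hF₂ hdisj hout h₂ h1 h3 hx''.2 hy''.1 hy''.2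
  refine blockConfig_mem_crudeCrossing_of_split_path R hδ s c γ' hF₀ hF₂ hdisj hout h₀ h₂
    (Or.inr hx'') ⟨t₂, by rw [infDist_zero_of_mem ht₂]; exact hδ.le⟩ h1 h3 h02 fun t v hv => ?_
  exact le_of_lt (α := ℝ) (hball t (mem_ball'.2 (hv.trans_lt hμ)))

/-! ### S4: the upper exclusion (crude block crossing and white fat tube are incompatible) -/

/-- **S4 — upper exclusion, deterministic part.**  Assume the crossing clause of
`upperMargins R R₂` at margin `r` (every path within `r` of `closure R₂` from within `r` of
`R₂.arc 0` to within `r` of `R₂.arc 2` meets every path within `r` of `Ω` from within `r` of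
`(ab)` to within `r` of `(cd)`), `2δ ≤ r`, `4ρ ≤ r`, `δ/2 < μ`.  Then a crude block crossing
`blockConfig δ s c ∈ crudeCrossing R δ` and a strictly WHITE fat tube `P` (open `μ`-balls strictly
white) shadowing within `4ρ` a path `P₀ ⊆ closure R₂` from `R₂.arc 0` to `R₂.arc 2` cannot
coexist: the polygonal interpolation `Q` of the open lattice path (segments of length `≤ δ`
between black sites of `Ω`, `dist_le_of_Gs_adj`; Part 4 `exists_joinedIn_of_mem_crudeCrossing`)
stays within `δ/2` of black sites of `Ω` and runs from within `2δ` of `(ab)` to within `2δ` of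
`(cd)`, so it meets `P`; the meeting point is within `δ/2 < μ` of a black site, which would then
be strictly white. [folklore] -/
theorem false_of_block_of_whiteTube (R R₂ : ConformalRectangle) {δ : ℝ} (hδ : 0 < δ) (s : ℝ)
    (c : PointConfig ℂ × PointConfig ℂ) {r ρ μ : ℝ}
    (hcross : ∀ (p₁ p₃ q₀ q₂ : ℂ) (P : Path p₁ p₃) (Q : Path q₀ q₂),
      infDist p₁ (R₂.arc 0) ≤ r → infDist p₃ (R₂.arc 2) ≤ r →
      (∀ t, infDist (P t) (closure R₂.carrier) ≤ r) →
      infDist q₀ (R.arc 0) ≤ r → infDist q₂ (R.arc 2) ≤ r → (∀ s, infDist (Q s) R.carrier ≤ r) →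
      ∃ t s, P t = Q s)
    (hδr : 2 * δ ≤ r) (hρr : 4 * ρ ≤ r) (hμ : δ / 2 < μ)
    (hblock : blockConfig δ s c ∈ crudeCrossing R δ)
    {p q : ℂ} {P₀ : Path p q} (hp : p ∈ R₂.arc 0) (hq : q ∈ R₂.arc 2)
    (hP₀ : ∀ t, P₀ t ∈ closure R₂.carrier)
    {p' q' : ℂ} (P : Path p' q') (hp' : dist p' p ≤ 4 * ρ) (hq' : dist q' q ≤ 4 * ρ)
    (hnear : ∀ t, ∃ u, dist (P t) (P₀ u) ≤ 4 * ρ)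
    (hball : ∀ t, ball (P t) μ ⊆ {z | infDist z ((s : ℂ) • (c.2 : Set ℂ)) <
      infDist z ((s : ℂ) • (c.1 : Set ℂ))}) :
    False := by
  -- the `δ/2`-neighbourhood of the black sites of `Ω`
  set K : Set ℂ := {z | ∃ v : (ℤ × ℤ) ⊕ (ℤ × ℤ), (δ : ℂ) * zGs v ∈ R.carrier ∧
    (δ : ℂ) * zGs v ∈ blackRegion ((s : ℂ) • (c.1 : Set ℂ)) ((s : ℂ) • (c.2 : Set ℂ)) ∧
    dist z ((δ : ℂ) * zGs v) ≤ δ / 2} with hK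
  have hmem : ∀ v ∈ blockConfig δ s c, (δ : ℂ) * zGs v ∈ R.carrier → (δ : ℂ) * zGs v ∈ K :=
    fun v hv hvΩ => ⟨v, hvΩ, hv, by rw [dist_self]; positivity⟩
  have hadj : ∀ v ∈ blockConfig δ s c, ∀ v' ∈ blockConfig δ s c, (δ : ℂ) * zGs v ∈ R.carrier →
      (δ : ℂ) * zGs v' ∈ R.carrier → Gs.Adj v v' →
      JoinedIn K ((δ : ℂ) * zGs v) ((δ : ℂ) * zGs v') := by
    intro v hv v' hv' hvΩ hv'Ω hvv'
    have hd : dist ((δ : ℂ) * zGs v) ((δ : ℂ) * zGs v') ≤ δ := dist_le_of_Gs_adj hδ.le hvv'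
    have hseg : segment ℝ ((δ : ℂ) * zGs v) ((δ : ℂ) * zGs v') ⊆ K := by
      intro z hz
      have hsum := dist_add_dist_of_mem_segment hz
      by_cases h : dist z ((δ : ℂ) * zGs v) ≤ δ / 2
      · exact ⟨v, hvΩ, hv, h⟩
      · refine ⟨v', hv'Ω, hv', ?_⟩
        rw [dist_comm] at h
        push Not at h
        linarith
    exact JoinedIn.of_segment_subset hseg
  -- the polygonal interpolation `Q` of the open lattice path
  obtain ⟨q₀, q₂, hq₀, hq₂, hJ⟩ := exists_joinedIn_of_mem_crudeCrossing R hblock hmem hadj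
  have hQ : ∀ u, hJ.somePath u ∈ K := fun u => hJ.somePath_mem u
  -- the white tube meets it
  obtain ⟨t, u, htu⟩ := hcross p' q' q₀ q₂ P hJ.somePath
    ((infDist_le_dist_of_mem hp).trans (hp'.trans hρr))
    ((infDist_le_dist_of_mem hq).trans (hq'.trans hρr))
    (fun t => by
      obtain ⟨u, hu⟩ := hnear t
      exact (infDist_le_dist_of_mem (hP₀ u)).trans (hu.trans hρr))
    (hq₀.trans hδr) (hq₂.trans hδr)
    (fun u => by
      obtain ⟨v, hvΩ, -, hd⟩ := hQ u
      exact (infDist_le_dist_of_mem hvΩ).trans (by linarith))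
  -- at the meeting point a black site lies in a strictly white ball
  obtain ⟨v, -, hvB, hd⟩ := hQ u
  have hσ : (δ : ℂ) * zGs v ∈ ball (P t) μ := by
    rw [mem_ball', htu]
    exact hd.trans_lt hμ
  exact (mem_blackRegion.1 hvB).not_gt (hball t hσ)

/-- **Registered sub-goal `stub_sandwich_of_part1`** of `stub_sandwich_of` (K1, S3 + S4): last
exit through `(cd)` of a path from the `(ab)`-side piece to the `(cd)`-side piece of a splitting
(the statement of `exists_mem_arc_two_of_split`). [folklore] -/
theorem stub_sandwich_of_part1 : ∀ (R : ConformalRectangle) {M : ℝ}, 0 < M → ∀ {x y : ℂ} (γ : Path x y) {F₀ F₂ : Set ℂ}, IsClosed F₀ → IsClosed F₂ → Disjoint F₀ F₂ → (∀ t, γ t ∉ closure R.carrier → γ t ∈ F₀ ∪ F₂) → (∀ z ∈ F₂, M < Metric.infDist z (R.arc 0)) → (∀ t, M < Metric.infDist (γ t) (R.arc 1)) → (∀ t, M < Metric.infDist (γ t) (R.arc 3)) → x ∈ F₀ → y ∉ closure R.carrier → y ∈ F₂ → ∃ t, γ t ∈ R.arc 2 :=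
  fun R _ hM _ _ γ _ _ hF₀ hF₂ hdisj hout h₂ h1 h3 hxF hy hyF =>
    exists_mem_arc_two_of_split R hM γ hF₀ hF₂ hdisj hout h₂ h1 h3 hxF hy hyF

end Summit.CriticalPhenomena.CardyFormulaZ2.Cruxes.SquareFromVoronoiHub.VoronoiBlocks.Faithful

end
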